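import Mathlib
import Summits.ValiantsHypothesis.ValiantsHypothesis.Theorems.RefutationDegreeDefs

/-!
# Balanced tuples of matrices have full non-commutative rank (Gurvits / King)

Stub `stub_ncFullRank_of_balanced` (D2) for the line `Sketch_ideator5` of the crux
`RefutationBarrier`: a non-zero tuple `(W_t)` of `m × m` complex matrices which is BALANCED,
`Σ_t W_t W_tᴴ = α·1 = Σ_t W_tᴴ W_t`, shrinks no subspace: `dim U ≤ dim (Σ_t W_t U)` for every
subspace `U ≤ ℂ^m` ("doubly stochastic operators have no shrunk subspace").

Proof (Bessel/Parseval form of Gurvits' trace argument).  Right balance says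
`Σ_t ‖W_t u‖² = α ‖u‖²`, left balance says `Σ_t ‖W_tᴴ v‖² = α ‖v‖²`, and `α > 0` as `W ≠ 0`.
Put `U' = Σ_t W_t U`, and pick orthonormal bases `(b_k)` of `Uᗮ` and `(c_l)` of `U'ᗮ`.  Since
`W_t U ≤ U'`, each `W_tᴴ c_l` lies in `Uᗮ`, so by Parseval in `Uᗮ` and Bessel for the family `(c_l)`,
`Σ_l ‖W_tᴴ c_l‖² = Σ_k Σ_l |⟪c_l, W_t b_k⟫|² ≤ Σ_k ‖W_t b_k‖²`.  Summing over `t` gives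
`α · dim U'ᗮ ≤ α · dim Uᗮ`, i.e. `dim U ≤ dim U'`.
-/

set_option linter.dupNamespace false

noncomputable section

open scoped InnerProductSpace
open Matrix

namespace Summit.ValiantsHypothesis.ValiantsHypothesis.Theorems.RefutationDegree

/-- Operator form of "balanced ⟹ no shrunk subspace": if `Σ_t ‖B_t u‖² = α‖u‖²` and
`Σ_t ‖B_t† v‖² = α‖v‖²` with `α > 0`, and every `B_t` maps `V` into `V'`, then
`dim V ≤ dim V'`. [folklore] -/
private theorem finrank_le_finrank_of_balanced_ops {E : Type*} [NormedAddCommGroup E]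
    [InnerProductSpace ℂ E] [FiniteDimensional ℂ E] {ι : Type*} [Fintype ι]
    (B : ι → E →L[ℂ] E) {α : ℝ} (hα : 0 < α)
    (hR : ∀ u : E, ∑ t, ‖B t u‖ ^ 2 = α * ‖u‖ ^ 2)
    (hL : ∀ v : E, ∑ t, ‖ContinuousLinearMap.adjoint (B t) v‖ ^ 2 = α * ‖v‖ ^ 2)
    (V V' : Submodule ℂ E) (hVV' : ∀ t, ∀ u ∈ V, B t u ∈ V') :
    Module.finrank ℂ V ≤ Module.finrank ℂ V' := by
  classical
  set b := stdOrthonormalBasis ℂ Vᗮ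
  set c := stdOrthonormalBasis ℂ V'ᗮ
  have hc : Orthonormal ℂ (fun l => (c l : E)) := c.orthonormal.comp_linearIsometry V'ᗮ.subtypeₗᵢ
  -- the key estimate, for each `t`
  have key : ∀ t, ∑ l, ‖ContinuousLinearMap.adjoint (B t) (c l : E)‖ ^ 2 ≤
      ∑ k, ‖B t (b k : E)‖ ^ 2 := by
    intro t
    have h1 : ∀ l, ‖ContinuousLinearMap.adjoint (B t) (c l : E)‖ ^ 2 =
        ∑ k, ‖⟪(c l : E), B t (b k : E)⟫_ℂ‖ ^ 2 := by
      intro l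
      have hw : ContinuousLinearMap.adjoint (B t) (c l : E) ∈ Vᗮ := by
        rw [Submodule.mem_orthogonal]
        intro u hu
        rw [ContinuousLinearMap.adjoint_inner_right]
        exact Submodule.inner_right_of_mem_orthogonal (hVV' t u hu) (c l).2
      calc ‖ContinuousLinearMap.adjoint (B t) (c l : E)‖ ^ 2
          = ‖(⟨_, hw⟩ : Vᗮ)‖ ^ 2 := rfl
        _ = ∑ k, ‖⟪((⟨_, hw⟩ : Vᗮ) : Vᗮ), b k⟫_ℂ‖ ^ 2 := (b.sum_sq_norm_inner_left _).symm
        _ = ∑ k, ‖⟪(c l : E), B t (b k : E)⟫_ℂ‖ ^ 2 := Finset.sum_congr rfl fun k _ => by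
            rw [Submodule.coe_inner, ContinuousLinearMap.adjoint_inner_left]
    calc ∑ l, ‖ContinuousLinearMap.adjoint (B t) (c l : E)‖ ^ 2
        = ∑ l, ∑ k, ‖⟪(c l : E), B t (b k : E)⟫_ℂ‖ ^ 2 := Finset.sum_congr rfl fun l _ => h1 l
      _ = ∑ k, ∑ l, ‖⟪(c l : E), B t (b k : E)⟫_ℂ‖ ^ 2 := Finset.sum_comm
      _ ≤ ∑ k, ‖B t (b k : E)‖ ^ 2 :=
          Finset.sum_le_sum fun k _ => hc.sum_inner_products_le _
  have hb1 : ∀ k, ‖(b k : E)‖ = 1 := fun k => by rw [Submodule.norm_coe]; exact b.norm_eq_one k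
  have hc1 : ∀ l, ‖(c l : E)‖ = 1 := fun l => by rw [Submodule.norm_coe]; exact c.norm_eq_one l
  have e1 : ∑ t, ∑ l, ‖ContinuousLinearMap.adjoint (B t) (c l : E)‖ ^ 2 =
      α * Module.finrank ℂ V'ᗮ := by
    rw [Finset.sum_comm]
    simp_rw [hL]
    simp only [hc1, one_pow, mul_one, Finset.sum_const, Finset.card_univ, Fintype.card_fin,
      nsmul_eq_mul]
    ring
  have e2 : ∑ t, ∑ k, ‖B t (b k : E)‖ ^ 2 = α * Module.finrank ℂ Vᗮ := by
    rw [Finset.sum_comm]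
    simp_rw [hR]
    simp only [hb1, one_pow, mul_one, Finset.sum_const, Finset.card_univ, Fintype.card_fin,
      nsmul_eq_mul]
    ring
  have hineq : α * (Module.finrank ℂ V'ᗮ : ℝ) ≤ α * (Module.finrank ℂ Vᗮ : ℝ) := by
    rw [← e1, ← e2]
    exact Finset.sum_le_sum fun t _ => key t
  have h3 : (Module.finrank ℂ V'ᗮ : ℝ) ≤ Module.finrank ℂ Vᗮ := le_of_mul_le_mul_left hineq hα
  have h4 : Module.finrank ℂ V'ᗮ ≤ Module.finrank ℂ Vᗮ := by exact_mod_cast h3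
  have h5 := Submodule.finrank_add_finrank_orthogonal V
  have h6 := Submodule.finrank_add_finrank_orthogonal V'
  omega

/-- If `Σ_t B_t† B_t = α·1` as operators then `Σ_t ‖B_t u‖² = α ‖u‖²`. [folklore] -/
private theorem sum_norm_sq_of_sum_star_mul_self {E : Type*} [NormedAddCommGroup E]
    [InnerProductSpace ℂ E] [CompleteSpace E] {ι : Type*} [Fintype ι]
    (B : ι → E →L[ℂ] E) {α : ℝ} (h : ∑ t, star (B t) * B t = (α : ℂ) • (1 : E →L[ℂ] E))
    (u : E) : ∑ t, ‖B t u‖ ^ 2 = α * ‖u‖ ^ 2 := by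
  have h' := congr_arg (fun T : E →L[ℂ] E => ⟪u, T u⟫_ℂ) h
  simp only [_root_.sum_apply, mul_apply_eq_comp, _root_.smul_apply, one_apply_eq_self, inner_sum,
    ContinuousLinearMap.star_eq_adjoint, ContinuousLinearMap.adjoint_inner_right,
    inner_self_eq_norm_sq_to_K, inner_smul_right] at h'
  rw [RCLike.ofReal_eq_complex_ofReal] at h'
  exact_mod_cast h'

/-- Matrix form: a non-zero balanced tuple of square matrices shrinks no subspace of `Fin m → ℂ`.
[folklore] -/
private theorem finrank_le_finrank_of_balanced_matrices {ι : Type*} [Fintype ι] {m : ℕ}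
    (M : ι → Matrix (Fin m) (Fin m) ℂ) (hM : M ≠ 0) {α : ℝ}
    (h1 : ∑ t, M t * (M t)ᴴ = (α : ℂ) • (1 : Matrix (Fin m) (Fin m) ℂ))
    (h2 : ∑ t, (M t)ᴴ * M t = (α : ℂ) • (1 : Matrix (Fin m) (Fin m) ℂ))
    (U : Submodule ℂ (Fin m → ℂ)) :
    Module.finrank ℂ U ≤ Module.finrank ℂ ↥(⨆ t, U.map (Matrix.toLin' (M t))) := by
  classical
  set φ := Matrix.toEuclideanCLM (n := Fin m) (𝕜 := ℂ) with hφ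
  set B : ι → EuclideanSpace ℂ (Fin m) →L[ℂ] EuclideanSpace ℂ (Fin m) := fun t => φ (M t)
    with hB
  -- the two balance identities, as operator identities
  have hRop : ∑ t, star (B t) * B t =
      (α : ℂ) • (1 : EuclideanSpace ℂ (Fin m) →L[ℂ] EuclideanSpace ℂ (Fin m)) := by
    have h := congr_arg φ h2
    rw [map_sum, map_smul, map_one] at h
    simpa only [map_mul, ← Matrix.star_eq_conjTranspose, map_star] using h
  have hLop : ∑ t, star (star (B t)) * star (B t) =
      (α : ℂ) • (1 : EuclideanSpace ℂ (Fin m) →L[ℂ] EuclideanSpace ℂ (Fin m)) := by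
    have h := congr_arg φ h1
    rw [map_sum, map_smul, map_one] at h
    simpa only [map_mul, ← Matrix.star_eq_conjTranspose, map_star, star_star] using h
  -- ... and as norm identities
  have hR : ∀ u : EuclideanSpace ℂ (Fin m), ∑ t, ‖B t u‖ ^ 2 = α * ‖u‖ ^ 2 :=
    sum_norm_sq_of_sum_star_mul_self B hRop
  have hL : ∀ v : EuclideanSpace ℂ (Fin m),
      ∑ t, ‖ContinuousLinearMap.adjoint (B t) v‖ ^ 2 = α * ‖v‖ ^ 2 := fun v => by
    simpa only [ContinuousLinearMap.star_eq_adjoint] using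
      sum_norm_sq_of_sum_star_mul_self (fun t => star (B t)) hLop v
  -- `α > 0` since `M ≠ 0`
  have hα : 0 < α := by
    by_contra hle
    have hle : α ≤ 0 := not_lt.mp hle
    apply hM
    funext t
    have hBt : B t = 0 := by
      ext1 u
      have hle' : ∑ s, ‖B s u‖ ^ 2 ≤ 0 :=
        (hR u).trans_le (mul_nonpos_of_nonpos_of_nonneg hle (sq_nonneg _))
      have h0 : ∑ s, ‖B s u‖ ^ 2 = 0 :=
        le_antisymm hle' (Finset.sum_nonneg fun s _ => sq_nonneg _)
      have := (Finset.sum_eq_zero_iff_of_nonneg fun s _ => sq_nonneg _).1 h0 t (Finset.mem_univ t)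
      simpa using this
    exact (map_eq_zero_iff φ φ.injective).1 hBt
  -- transport the subspaces to Euclidean space
  let e : EuclideanSpace ℂ (Fin m) ≃ₗ[ℂ] (Fin m → ℂ) := (EuclideanSpace.equiv (Fin m) ℂ).toLinearEquiv
  have hV := finrank_le_finrank_of_balanced_ops B hα hR hL
    (U.map (e.symm : (Fin m → ℂ) →ₗ[ℂ] EuclideanSpace ℂ (Fin m)))
    ((⨆ t, U.map (Matrix.toLin' (M t))).map (e.symm : (Fin m → ℂ) →ₗ[ℂ] EuclideanSpace ℂ (Fin m)))
    ?_
  · rwa [LinearEquiv.finrank_map_eq, LinearEquiv.finrank_map_eq] at hV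
  · intro t u hu
    obtain ⟨x, hx, rfl⟩ := Submodule.mem_map.mp hu
    have hx' : Matrix.toLin' (M t) x ∈ ⨆ t, U.map (Matrix.toLin' (M t)) :=
      Submodule.mem_iSup_of_mem t (Submodule.mem_map_of_mem hx)
    exact Submodule.mem_map.mpr ⟨_, hx', rfl⟩

/-- **Stub D2 (balanced ⟹ full non-commutative rank; Gurvits / King).**  A non-zero balanced tuple
has no shrunk subspace: for every subspace `U` of `ℂ^m`, `dim U ≤ dim (Σ_t W_t U)`.  Proof: with
`P` the orthogonal projection onto `U` and `Q` onto `U' = Σ_t W_t U`,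
`α·dim U = tr Σ_t W_t P W_tᴴ ≤ tr (Q · Σ_t W_t W_tᴴ) = α·dim U'`, and `α = ‖W‖²_F / m > 0`
(here in the equivalent Bessel/Parseval form on the complements `Uᗮ`, `U'ᗮ`). [folklore] -/
theorem stub_ncFullRank_of_balanced (n m : ℕ) (W : Unk n m → ℂ) (hW : W ≠ 0)
    (hbal : ∃ α : ℝ,
      (∑ t : Option (Fin n × Fin n),
          (Matrix.of fun i j : Fin m => W (t, (i, j))) *
            (Matrix.of fun i j : Fin m => W (t, (i, j)))ᴴ) =
        (α : ℂ) • (1 : Matrix (Fin m) (Fin m) ℂ) ∧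
      (∑ t : Option (Fin n × Fin n),
          (Matrix.of fun i j : Fin m => W (t, (i, j)))ᴴ *
            (Matrix.of fun i j : Fin m => W (t, (i, j)))) =
        (α : ℂ) • (1 : Matrix (Fin m) (Fin m) ℂ)) :
    ∀ U : Submodule ℂ (Fin m → ℂ),
      Module.finrank ℂ U ≤
        Module.finrank ℂ
          ↥(⨆ t : Option (Fin n × Fin n),
              U.map (Matrix.toLin' (Matrix.of fun i j : Fin m => W (t, (i, j))))) := by
  intro U
  obtain ⟨α, h1, h2⟩ := hbal
  have hM : (fun t : Option (Fin n × Fin n) => Matrix.of fun i j : Fin m => W (t, (i, j))) ≠ 0 := by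
    intro h0
    apply hW
    funext ⟨t, i, j⟩
    have := congr_fun (congr_fun (congr_fun h0 t) i) j
    simpa using this
  exact finrank_le_finrank_of_balanced_matrices _ hM h1 h2 U

end Summit.ValiantsHypothesis.ValiantsHypothesis.Theorems.RefutationDegree

end
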